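import Mathlib.Combinatorics.Configuration
import Mathlib.Tactic.DeriveFintype
import HarnessLib

/-!
# Runbook sanity: Mathlib's `Configuration.ProjectivePlane` is inhabited — the Fano plane PG(2,2), of order 2

Framing (verbatim for the cell): lottery ticket; floor = certified bounds/negative ranges.

REVIEW-RUNBOOK card (2)(b) row for cell `pub-namedobj`, target M (`PP12.Collineation.prime_order_atlas_order12` quantifies over
`[Configuration.ProjectivePlane P L]` with `ProjectivePlane.order P L = 12`).  The class itself is satisfiable: the seven points and seven
lines of the Fano plane (lines = translates of the perfect difference set `{0, 1, 3} ⊂ ℤ/7`) form a `ProjectivePlane` of order 2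
(`fano_order`).  WHAT CANNOT BE WITNESSED, and why: the telescope with `order P L = 12` — whether a projective plane of order 12 exists is
the open problem the census attacks; the theorem is a constraint on a hypothetical object and is advertised as such.
Ops-runbook seat; nothing here is a claim about the census rows.
-/

namespace Summit.Ventures.DiscreteObjects.Runbook

open Configuration

/-- A point of the Fano plane: a residue mod 7. -/
structure FanoPoint where
  /-- the residue -/
  val : Fin 7
deriving DecidableEq, Fintype

/-- A line of the Fano plane: the translate `{j, j+1, j+3}` of the difference set `{0,1,3}`, named by `j : Fin 7`. -/
structure FanoLine where
  /-- the translation parameter -/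
  val : Fin 7
deriving DecidableEq, Fintype

/-- incidence: the point `i` lies on the line `j` iff `i − j ∈ {0, 1, 3}` (mod 7). -/
def fanoInc (l : FanoLine) (p : FanoPoint) : Bool :=
  (p.val - l.val = 0) || (p.val - l.val = 1) || (p.val - l.val = 3)

/-- incidence as a `Membership` instance (Mathlib's configuration API: `p ∈ l`). -/
instance fanoMembership : Membership FanoPoint FanoLine := ⟨fun l p => fanoInc l p = true⟩

/-- incidence is decidable (it is a Boolean test). -/
instance fanoMemDecidable (p : FanoPoint) (l : FanoLine) : Decidable (p ∈ l) :=
  inferInstanceAs (Decidable (fanoInc l p = true))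

/-- all seven lines, as a list -/
def fanoLines : List FanoLine := (List.finRange 7).map FanoLine.mk

/-- all seven points, as a list -/
def fanoPoints : List FanoPoint := (List.finRange 7).map FanoPoint.mk

/-- the line through two points (any line containing both; the first line if `p = q`). -/
def fanoLineThrough (p q : FanoPoint) : FanoLine :=
  (fanoLines.find? fun l => decide (p ∈ l) && decide (q ∈ l)).getD ⟨0⟩

/-- the intersection point of two lines (any common point; the first point if `l = m`). -/
def fanoPointOn (l m : FanoLine) : FanoPoint :=
  (fanoPoints.find? fun p => decide (p ∈ l) && decide (p ∈ m)).getD ⟨0⟩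

/-- two distinct points lie on the line `fanoLineThrough` assigns to them (checked over all 42 ordered pairs). [folklore] -/
theorem fano_mkLine_ax : ∀ p q : FanoPoint, p ≠ q → p ∈ fanoLineThrough p q ∧ q ∈ fanoLineThrough p q := by
  decide

/-- two distinct lines meet in the point `fanoPointOn` assigns to them. [folklore] -/
theorem fano_mkPoint_ax : ∀ l m : FanoLine, l ≠ m → fanoPointOn l m ∈ l ∧ fanoPointOn l m ∈ m := by
  decide

/-- every line misses some point. [folklore] -/
theorem fano_exists_point : ∀ l : FanoLine, ∃ p : FanoPoint, p ∉ l := by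
  decide

/-- every point is missed by some line. [folklore] -/
theorem fano_exists_line : ∀ p : FanoPoint, ∃ l : FanoLine, p ∉ l := by
  decide

/-- two points and two lines pairwise incident: the points coincide or the lines do (2401 cases, `decide`). [folklore] -/
theorem fano_eq_or_eq : ∀ (p₁ p₂ : FanoPoint) (l₁ l₂ : FanoLine), p₁ ∈ l₁ → p₂ ∈ l₁ → p₁ ∈ l₂ → p₂ ∈ l₂ → p₁ = p₂ ∨ l₁ = l₂ := by
  decide

/-- three points in general position with three lines, as `ProjectivePlane.exists_config` demands. [folklore] -/
theorem fano_exists_config : ∃ (p₁ p₂ p₃ : FanoPoint) (l₁ l₂ l₃ : FanoLine),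
    p₁ ∉ l₂ ∧ p₁ ∉ l₃ ∧ p₂ ∉ l₁ ∧ p₂ ∈ l₂ ∧ p₂ ∈ l₃ ∧ p₃ ∉ l₁ ∧ p₃ ∈ l₂ ∧ p₃ ∉ l₃ := by
  decide

/-- **The Fano plane is a projective plane** in Mathlib's sense (`Configuration.ProjectivePlane`). [folklore] -/
instance fanoProjectivePlane : ProjectivePlane FanoPoint FanoLine where
  exists_point := fano_exists_point
  exists_line := fano_exists_line
  eq_or_eq := fun {p₁ p₂ l₁ l₂} h₁ h₂ h₃ h₄ => fano_eq_or_eq p₁ p₂ l₁ l₂ h₁ h₂ h₃ h₄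
  mkPoint := fun {l m} _ => fanoPointOn l m
  mkPoint_ax := fun {l m} h => fano_mkPoint_ax l m h
  mkLine := fun {p q} _ => fanoLineThrough p q
  mkLine_ax := fun {p q} h => fano_mkLine_ax p q h
  exists_config := fano_exists_config

/-- The Fano plane has 7 points. [folklore] -/
theorem fano_card_points : Fintype.card FanoPoint = 7 := by
  decide

/-- **The Fano plane has order 2** (so `Configuration.ProjectivePlane` is inhabited, at the smallest order). [folklore] -/
theorem fano_order : ProjectivePlane.order FanoPoint FanoLine = 2 := by
  have h := ProjectivePlane.card_points FanoPoint FanoLine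
  rw [fano_card_points] at h
  set n := ProjectivePlane.order FanoPoint FanoLine with hn
  have hle : n ≤ 2 := by
    by_contra hlt
    have h3 : 3 ≤ n := by omega
    nlinarith
  interval_cases n <;> omega

end Summit.Ventures.DiscreteObjects.Runbook
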